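import Summits.AnomalousDissipation.AnomalousDissipation.Theorems.ScalarAnomalySteadySourceFormal.Negative.WienFlux

/-!
# Negative knowledge for the crux `ScalarAnomalySteadySourceFormal` (stmt-AnomalousDissipation-0448), X-e:
# Wiener-class stirring — the square-band inequality along the weak solution

Certified copy of §12.5 of the cdisprove work file.  The band inequality of `Negative.WienBand`
(along the representatives) is transported back to the modes `y_p(t) = 𝓕θ(t)(p)` of the weak solution
(equal a.e.), the boundary flux is bounded shift by shift (`Negative.WienFlux`) and the resulting
series of time integrals is summed (`integral_tsum`): for the band `sbox K' \\ sbox K`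
(`wband_modes_le`),
`2ν ∑_{p∈𝔅} 4π²|p|² q_p ≤ ‖θ₀‖² + 4π ∑' q ∫_{(0,T)} wFluxBound a K K' y(t) q dt + 2 η_𝔅 ∫_{(0,T)} ‖θ(t)‖`,
with `∫ wFluxBound(q) = 2 a_q ((K+r_q) ∫ slayerSum_{K,r_q} + (K'+r_q) ∫ slayerSum_{K',r_q})`
(`integral_wFluxBound`).

Supports stmt-AnomalousDissipation-0448 (the Wiener-class no-go, files `Wien*`).
-/

set_option linter.dupNamespace false

noncomputable section

open scoped BigOperators Topology ENNReal NNReal InnerProductSpace ContDiff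
open Filter Set Function MeasureTheory UnitAddTorus Complex

namespace Summit.AnomalousDissipation.AnomalousDissipation.Theorems.ScalarAnomalySteadySourceFormal.Negative

open Literature.Analysis
open Literature.Analysis.FunctionSpaces Literature.Analysis.FunctionSpaces.Torus
open Literature.Analysis.FluidPDE Literature.Analysis.FluidPDE.Torus

/-- The frequency lattice `ℤ²` (local notation). -/
local notation "ℤ²" => Fin 2 → ℤ

section WLimit

variable {ν : ℝ} {C : ℝ → ℤ² → EuclideanSpace ℂ (Fin 2)} {a : ℤ² → ℝ}
  {u : ℝ → UnitAddTorus (Fin 2) → EuclideanSpace ℝ (Fin 2)} {h θ₀ : UnitAddTorus (Fin 2) → ℝ}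
  {θ : ℝ → UnitAddTorus (Fin 2) → ℝ}

/-- **From representatives back to the solution** (Wiener-class): set integrals over `(0,T)` of any
functional of the mode vector agree. [folklore] -/
theorem setIntegral_wcmodes_eq (hw : IsWeakScalarTransportForced ν u (fun _ => h) θ₀ θ)
    (hu : ∀ s, u s = wienField (C s)) (hCa : ∀ s q, ‖C s q‖ ≤ a q) (hsa : Summable a)
    (hsymm : ∀ s q, C s (-q) = EuclideanSpace.conjVec (C s q))
    (hh : Integrable h volume) (hθ₀ : Integrable θ₀ volume) {T : ℝ} (hT : 0 < T) (Φ : ℝ → (ℤ² → ℂ) → ℝ) :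
    ∫ t in Ioo 0 T, Φ t (wcmodes ν C h θ₀ θ t) = ∫ t in Ioo 0 T, Φ t (modes θ t) := by
  refine integral_congr_ae ?_
  filter_upwards [ae_modes_eq_wcmodes hw hu hCa hsa hsymm hh hθ₀ hT] with t ht
  rw [show modes θ t = wcmodes ν C h θ₀ θ t from funext ht]

/-- Integrability of the shift bound along the solution, and its integral. [folklore] -/
theorem integrableOn_wFluxBound {T : ℝ} (hw : IsWeakScalarTransportForcedOn T ν u (fun _ => h) θ₀ θ) (K K' : ℤ) (q : ℤ²) :
    IntegrableOn (fun t => wFluxBound a K K' (modes θ t) q) (Ioo 0 T) volume := by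
  unfold wFluxBound slayerSum
  have h1 := forced_integrableOn_sum_sq_modes hw (slayer (K - qrad q) (K + qrad q)) (fun _ => 1)
  have h2 := forced_integrableOn_sum_sq_modes hw (slayer (K' - qrad q) (K' + qrad q)) (fun _ => 1)
  simp only [one_mul] at h1 h2
  exact (((h1.const_mul _).add (h2.const_mul _)).const_mul _)

/-- `∫ wFluxBound(q) = 2 a_q ((K+r_q) ∫ slayerSum_{K} + (K'+r_q) ∫ slayerSum_{K'})`. [folklore] -/
theorem integral_wFluxBound {T : ℝ} (hw : IsWeakScalarTransportForcedOn T ν u (fun _ => h) θ₀ θ) (K K' : ℤ) (q : ℤ²) :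
    ∫ t in Ioo 0 T, wFluxBound a K K' (modes θ t) q =
      2 * a q * ((K + qrad q) * (∫ t in Ioo 0 T, slayerSum (K - qrad q) (K + qrad q) (modes θ t)) +
        (K' + qrad q) * ∫ t in Ioo 0 T, slayerSum (K' - qrad q) (K' + qrad q) (modes θ t)) := by
  unfold wFluxBound
  have h1 : IntegrableOn (fun t => slayerSum (K - qrad q) (K + qrad q) (modes θ t)) (Ioo 0 T) volume := by
    simpa [slayerSum] using forced_integrableOn_sum_sq_modes hw (slayer (K - qrad q) (K + qrad q)) (fun _ => 1)
  have h2 : IntegrableOn (fun t => slayerSum (K' - qrad q) (K' + qrad q) (modes θ t)) (Ioo 0 T) volume := by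
    simpa [slayerSum] using forced_integrableOn_sum_sq_modes hw (slayer (K' - qrad q) (K' + qrad q)) (fun _ => 1)
  rw [integral_const_mul, integral_add (h1.const_mul _) (h2.const_mul _), integral_const_mul, integral_const_mul]

/-- Pointwise bound of the shift bound along the solution: `wFluxBound(q)(t) ≤ (2(K+K') a_q + 4 r_q a_q) ‖θ(t)‖²` a.e. [folklore] -/
theorem ae_wFluxBound_le {T : ℝ} (hw : IsWeakScalarTransportForcedOn T ν u (fun _ => h) θ₀ θ) (hCa : ∀ s q, ‖C s q‖ ≤ a q)
    {K K' : ℤ} (hK : 0 ≤ K) (hK' : 0 ≤ K') (q : ℤ²) :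
    ∀ᵐ t ∂(volume.restrict (Ioo 0 T)),
      wFluxBound a K K' (modes θ t) q ≤ (2 * (K + K') * a q + 4 * (qrad q * a q)) * scalarL2Sq (θ t) := by
  have ha : ∀ q, 0 ≤ a q := fun q => (norm_nonneg _).trans (hCa 0 q)
  filter_upwards [forced_ae_memLp_two hw] with t ht
  have hV : ∀ F : Finset ℤ², ∑ p ∈ F, ‖modes θ t p‖ ^ 2 ≤ scalarL2Sq (θ t) :=
    fun F => sum_sq_norm_mFourierCoeff_le_integral_sq ht F
  have := wFluxBound_le ha hV hK hK' q
  linarith [this]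

/-- **Time integral of the flux series = series of time integrals**, with the bound
`∫ ‖wBdryFlux‖ ≤ ∑' q ∫ wFluxBound(q)` (first moment of the majorant). [folklore] -/
theorem integral_norm_wBdryFlux_le (hw : IsWeakScalarTransportForced ν u (fun _ => h) θ₀ θ)
    (hu : ∀ s, u s = wienField (C s)) (hCa : ∀ s q, ‖C s q‖ ≤ a q) (hsa : Summable a)
    (hsa1 : Summable fun q => (qrad q : ℝ) * a q)
    (hsymm : ∀ s q, C s (-q) = EuclideanSpace.conjVec (C s q)) (hcont : ∀ q, Continuous fun s => C s q)
    (hh : Integrable h volume) (hθ₀ : Integrable θ₀ volume) {T : ℝ} (hT : 0 < T) {K K' : ℤ} (hK : 0 ≤ K) (hK' : 0 ≤ K') :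
    ∫ t in Ioo 0 T, ‖wBdryFlux (box K' K' \ box K K) (C t) (modes θ t)‖ ≤
      ∑' q, ∫ t in Ioo 0 T, wFluxBound a K K' (modes θ t) q := by
  have hwT := hw T hT
  have ha : ∀ q, 0 ≤ a q := fun q => (norm_nonneg _).trans (hCa 0 q)
  obtain ⟨B, hB0, hB⟩ := forced_ae_norm_modes_le hwT
  -- pointwise (a.e.) flux bound
  have hpt : ∀ᵐ t ∂(volume.restrict (Ioo 0 T)),
      ‖wBdryFlux (box K' K' \ box K K) (C t) (modes θ t)‖ ≤ ∑' q, wFluxBound a K K' (modes θ t) q := by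
    filter_upwards [hB, forced_ae_memLp_two hwT] with t ht hm
    exact norm_wBdryFlux_le_tsum hK hK' (hCa t) hsa hsa1 ht (fun F => sum_sq_norm_mFourierCoeff_le_integral_sq hm F)
  -- the series of time integrals
  have hmeas : ∀ q, AEStronglyMeasurable (fun t => wFluxBound a K K' (modes θ t) q) (volume.restrict (Ioo 0 T)) :=
    fun q => (integrableOn_wFluxBound hwT K K' q).aestronglyMeasurable
  have hVi := forced_integrableOn_scalarL2Sq hwT
  have hsumI : ∑' q, ∫⁻ t in Ioo 0 T, ‖wFluxBound a K K' (modes θ t) q‖ₑ ≠ ⊤ := by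
    have hle : ∀ q, ∫⁻ t in Ioo 0 T, ‖wFluxBound a K K' (modes θ t) q‖ₑ ≤
        ENNReal.ofReal (2 * (K + K') * a q + 4 * (qrad q * a q)) * ∫⁻ t in Ioo 0 T, ‖scalarL2Sq (θ t)‖ₑ := by
      intro q
      have haq := ha q
      have hK0 : (0 : ℝ) ≤ K := by exact_mod_cast hK
      have hK'0 : (0 : ℝ) ≤ K' := by exact_mod_cast hK'
      have hc0 : 0 ≤ 2 * (K + K') * a q + 4 * (qrad q * a q) := by positivity
      rw [← lintegral_const_mul' _ _ ENNReal.ofReal_ne_top]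
      refine lintegral_mono_ae ?_
      filter_upwards [ae_wFluxBound_le hwT hCa hK hK' q] with t ht
      rw [← ofReal_norm, ← ofReal_norm, ← ENNReal.ofReal_mul hc0, Real.norm_eq_abs,
        abs_of_nonneg (wFluxBound_nonneg ha hK hK' _ _), Real.norm_eq_abs, abs_of_nonneg (scalarL2Sq_nonneg _)]
      exact ENNReal.ofReal_le_ofReal ht
    refine ne_top_of_le_ne_top ?_ (ENNReal.tsum_le_tsum hle)
    rw [ENNReal.tsum_mul_right]
    refine ENNReal.mul_ne_top ?_ hVi.2.ne
    have hK0 : (0 : ℝ) ≤ K := by exact_mod_cast hK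
    have hK'0 : (0 : ℝ) ≤ K' := by exact_mod_cast hK'
    rw [← ENNReal.ofReal_tsum_of_nonneg (fun q => by have := ha q; positivity) ((hsa.mul_left _).add (hsa1.mul_left _))]
    exact ENNReal.ofReal_ne_top
  have hint : Integrable (fun t => ∑' q, wFluxBound a K K' (modes θ t) q) (volume.restrict (Ioo 0 T)) := by
    -- integrable: a.e. bounded by a summable constant times `‖θ‖²`
    have hbound : ∀ᵐ t ∂(volume.restrict (Ioo 0 T)), ‖∑' q, wFluxBound a K K' (modes θ t) q‖ ≤
        (∑' q, (2 * (K + K') * a q + 4 * (qrad q * a q))) * scalarL2Sq (θ t) := by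
      have hall : ∀ᵐ t ∂(volume.restrict (Ioo 0 T)), ∀ q, wFluxBound a K K' (modes θ t) q ≤
          (2 * (K + K') * a q + 4 * (qrad q * a q)) * scalarL2Sq (θ t) := ae_all_iff.2 fun q => ae_wFluxBound_le hwT hCa hK hK' q
      filter_upwards [hall, forced_ae_memLp_two hwT] with t ht hm
      have hV : ∀ F : Finset ℤ², ∑ p ∈ F, ‖modes θ t p‖ ^ 2 ≤ scalarL2Sq (θ t) :=
        fun F => sum_sq_norm_mFourierCoeff_le_integral_sq hm F
      have hs := summable_wFluxBound ha hsa hsa1 hV hK hK'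
      rw [Real.norm_eq_abs, abs_of_nonneg (tsum_nonneg fun q => wFluxBound_nonneg ha hK hK' _ _), ← tsum_mul_right]
      exact Summable.tsum_le_tsum ht hs (((hsa.mul_left _).add (hsa1.mul_left _)).mul_right _)
    have hm2 : AEStronglyMeasurable (fun t => ∑' q, wFluxBound a K K' (modes θ t) q) (volume.restrict (Ioo 0 T)) := by
      -- a.e. limit of the partial sums over the boxes
      have hlim : ∀ᵐ t ∂(volume.restrict (Ioo 0 T)), Tendsto (fun n : ℕ => ∑ q ∈ box (n : ℤ) n, wFluxBound a K K' (modes θ t) q)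
          atTop (nhds (∑' q, wFluxBound a K K' (modes θ t) q)) := by
        filter_upwards [forced_ae_memLp_two hwT] with t hm
        have hV : ∀ F : Finset ℤ², ∑ p ∈ F, ‖modes θ t p‖ ^ 2 ≤ scalarL2Sq (θ t) :=
          fun F => sum_sq_norm_mFourierCoeff_le_integral_sq hm F
        exact (summable_wFluxBound ha hsa hsa1 hV hK hK').hasSum.comp tendsto_sbox_atTop
      exact aestronglyMeasurable_of_tendsto_ae atTop (fun n => Finset.aestronglyMeasurable_fun_sum _ fun q _ => hmeas q) hlim
    exact (hVi.const_mul _).mono' hm2 hbound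
  calc ∫ t in Ioo 0 T, ‖wBdryFlux (box K' K' \ box K K) (C t) (modes θ t)‖
      ≤ ∫ t in Ioo 0 T, ∑' q, wFluxBound a K K' (modes θ t) q := by
        refine integral_mono_ae ?_ hint hpt
        -- integrability of the flux norm: a version of the continuous-on-(0,T), bounded one along reps
        have e : (fun t => ‖wBdryFlux (box K' K' \ box K K) (C t) (modes θ t)‖) =ᵐ[volume.restrict (Ioo 0 T)]
            fun t => ‖wBdryFlux (box K' K' \ box K K) (C t) (wcmodes ν C h θ₀ θ t)‖ := by
          filter_upwards [ae_modes_eq_wcmodes hw hu hCa hsa hsymm hh hθ₀ hT] with t ht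
          rw [show modes θ t = wcmodes ν C h θ₀ θ t from funext ht]
        obtain ⟨Kb, hKb⟩ := norm_wBdryFlux_wcmodes_le hw hu hCa hsa hsymm hcont hh hθ₀ hT (box K' K' \ box K K)
        have hFm : AEStronglyMeasurable (fun t => wBdryFlux (box K' K' \ box K K) (C t) (wcmodes ν C h θ₀ θ t)) (volume.restrict (Ioo 0 T)) :=
          (continuousOn_wBdryFlux hw hu hCa hsa hsymm hcont hh hθ₀ hT _).aestronglyMeasurable measurableSet_Ioo
        have iFn : IntegrableOn (fun t => ‖wBdryFlux (box K' K' \ box K K) (C t) (wcmodes ν C h θ₀ θ t)‖) (Ioo 0 T) volume := by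
          refine IntegrableOn.of_bound measure_Ioo_lt_top hFm.norm Kb ?_
          exact (ae_restrict_iff' measurableSet_Ioo).2 (Eventually.of_forall fun t ht => by rw [norm_norm]; exact hKb t ht)
        exact iFn.congr e.symm
    _ = ∑' q, ∫ t in Ioo 0 T, wFluxBound a K K' (modes θ t) q := integral_tsum hmeas hsumI

/-- **The square-band inequality along the weak solution** (Wiener-class stirring). [folklore] -/
theorem wband_modes_le (hw : IsWeakScalarTransportForced ν u (fun _ => h) θ₀ θ)
    (hu : ∀ s, u s = wienField (C s)) (hCa : ∀ s q, ‖C s q‖ ≤ a q) (hsa : Summable a)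
    (hsa1 : Summable fun q => (qrad q : ℝ) * a q)
    (hsymm : ∀ s q, C s (-q) = EuclideanSpace.conjVec (C s q)) (hcont : ∀ q, Continuous fun s => C s q)
    (htrans : ∀ s q, zdot q (C s q) = 0)
    (hh : Integrable h volume) (hθ₀ : MemLp θ₀ 2 volume) {T : ℝ} (hT : 0 < T) {K K' : ℤ} (hK : 0 ≤ K) (hK' : 0 ≤ K') :
    2 * ν * ∫ t in Ioo 0 T, bandDiss (box K' K' \ box K K) (modes θ t) ≤
      scalarL2Sq θ₀ + 4 * Real.pi * (∑' q, ∫ t in Ioo 0 T, wFluxBound a K K' (modes θ t) q) +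
        2 * sourceMass (box K' K' \ box K K) h * ∫ t in Ioo 0 T, Real.sqrt (scalarL2Sq (θ t)) := by
  classical
  set 𝔅 := box K' K' \ box K K with h𝔅
  have hθ₀i : Integrable θ₀ volume := hθ₀.integrable one_le_two
  have hwT := hw T hT
  have hband := wband_dissipation_le hw hu hCa hsa hsymm hcont htrans hh hθ₀i hT 𝔅
  rw [setIntegral_wcmodes_eq hw hu hCa hsa hsymm hh hθ₀i hT (fun _ Y => bandDiss 𝔅 Y),
    setIntegral_wcmodes_eq hw hu hCa hsa hsymm hh hθ₀i hT (fun t Y => ‖wBdryFlux 𝔅 (C t) Y‖),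
    setIntegral_wcmodes_eq hw hu hCa hsa hsymm hh hθ₀i hT (fun _ Y => ‖sourcePairing 𝔅 h Y‖)] at hband
  have h0 : bandEnergy 𝔅 (fun p => mFourierCoeff (fun x => (θ₀ x : ℂ)) p) ≤ scalarL2Sq θ₀ :=
    sum_sq_norm_mFourierCoeff_le_integral_sq hθ₀ 𝔅
  have hflux := integral_norm_wBdryFlux_le hw hu hCa hsa hsa1 hsymm hcont hh hθ₀i hT hK hK'
  -- the source pairing, via Cauchy–Schwarz and Bessel (integrability from a.e.-equality with the continuous version)
  have hsrc : ∫ t in Ioo 0 T, ‖sourcePairing 𝔅 h (modes θ t)‖ ≤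
      sourceMass 𝔅 h * ∫ t in Ioo 0 T, Real.sqrt (scalarL2Sq (θ t)) := by
    have hPc : ContinuousOn (fun t => sourcePairing 𝔅 h (wcmodes ν C h θ₀ θ t)) (Icc 0 T) := by
      unfold sourcePairing
      exact continuousOn_finsetSum _ fun p _ => continuousOn_const.mul (continuousOn_wcmodes hw hCa hsa hcont hT p).star
    have hiP : IntegrableOn (fun t => ‖sourcePairing 𝔅 h (modes θ t)‖) (Ioo 0 T) volume := by
      refine integrableOn_of_ae_eq_continuousOn hPc.norm ?_
      filter_upwards [ae_modes_eq_wcmodes hw hu hCa hsa hsymm hh hθ₀i hT] with t ht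
      rw [show modes θ t = wcmodes ν C h θ₀ θ t from funext ht]
    rw [← integral_const_mul]
    refine integral_mono_ae hiP ((forced_integrableOn_sqrt_scalarL2Sq hwT).const_mul _) ?_
    filter_upwards [forced_ae_sum_sq_modes_le hwT 𝔅] with t ht
    refine (norm_sourcePairing_le 𝔅 h (modes θ t)).trans ?_
    exact mul_le_mul_of_nonneg_left (Real.sqrt_le_sqrt ht) (sourceMass_nonneg _ _)
  have hπ := Real.pi_pos
  have hsm := sourceMass_nonneg 𝔅 h
  calc 2 * ν * ∫ t in Ioo 0 T, bandDiss 𝔅 (modes θ t)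
      ≤ bandEnergy 𝔅 (fun p => mFourierCoeff (fun x => (θ₀ x : ℂ)) p) +
          4 * Real.pi * (∫ t in Ioo 0 T, ‖wBdryFlux 𝔅 (C t) (modes θ t)‖) +
          2 * ∫ t in Ioo 0 T, ‖sourcePairing 𝔅 h (modes θ t)‖ := hband
    _ ≤ scalarL2Sq θ₀ + 4 * Real.pi * (∑' q, ∫ t in Ioo 0 T, wFluxBound a K K' (modes θ t) q) +
          2 * (sourceMass 𝔅 h * ∫ t in Ioo 0 T, Real.sqrt (scalarL2Sq (θ t))) := by gcongr
    _ = _ := by ring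

end WLimit

end Summit.AnomalousDissipation.AnomalousDissipation.Theorems.ScalarAnomalySteadySourceFormal.Negative
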